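import Summits.AnomalousDissipation.AnomalousDissipation.Theorems.SawtoothPulseCascadeK1LocalisedCascadeFlatSlope

/-!
# K1loc, line `Spectral` / SeqCone — helper: THE MEASURE OF THE ROUNDED ZONES OF THE CASCADE PROFILE (S-B/S-C data)

Helper file of the prover lane on the crux `K1LocalisedCascade` (stmt-AnomalousDissipation-19491), route
`SawtoothPulseCascade` (memo v6 §2/§3: the zone junk `η_j`).  `…FlatSlope` proves that `M δ_j`-inside an ascending
(descending) branch of the phase `θ = 2πN_j y` the cascade profile has slope within `2e^{−M²/2}` of `+1` (`−1`).  Here the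
complement is measured: every phase is either within `r` of a corner `π/2 + πm` or `r`-inside a branch (`flat_or_near_corner`,
a floor/parity argument), so the ZONE
  `Z_j(M) = {y ∈ [0,1) : |U_j′(y) − 1| > 2e^{−M²/2} and |U_j′(y) + 1| > 2e^{−M²/2}}`
lies in the union of the `2N_j + 2` intervals of radius `Mδ_j/(2πN_j)` around the corners `y_m = (π/2 + πm)/(2πN_j)`,
`−1 ≤ m ≤ 2N_j` (`zone_subset_iUnion`, for `Mδ_j ≤ π/2`), hence `vol Z_j(M) ≤ (2N_j + 2)·Mδ_j/(πN_j) ≤ 4Mδ_j/π`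
(`volume_zone_le`, `volume_zone_le'`) — the summable zone measures of the cascade (`δ_j = δ₀ d^{−j}`), which bound the zone
junk of the half-slot bookkeeping through the maximum principle (`…SlotRestart`).  With the strip cut-offs of `…StripCutoff`
(`ε = e^{−M²/2}`), `{X⁺ + X⁻ < 1} ⊆ {|U′| < 1 − ε} ⊆ Z_j(M)`.  No definitions; no statement about the stub.
[cite: ElgindiLissMattingly2025, §1 (corner strips of the sawtooth shears; here Gaussian-rounded)] [problem: turb]
-/

-- `Summit.<Summit>.<Problem>`: single-conjunct summit, the duplicate namespace segment is deliberate.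
set_option linter.dupNamespace false

noncomputable section

namespace Summit.AnomalousDissipation.AnomalousDissipation.Theorems.SawtoothPulseCascade.K1Flat

open MeasureTheory Set Filter Topology
open scoped ENNReal
open Literature.Analysis.FluidPDE.SawtoothCascade

/-! ## Every phase is near a corner or inside a branch -/

/-- **Trichotomy of the phase.**  For `r > 0` and any `θ`: either `θ` is within `r` of a corner `π/2 + πm`, or it is
`r`-inside an ascending branch `(−π/2 + 2πk, π/2 + 2πk)`, or `r`-inside a descending branch `(π/2 + 2πk, 3π/2 + 2πk)`
(take `m = ⌊(θ + π/2)/π⌋` and split on its parity). [folklore] -/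
theorem flat_or_near_corner (θ r : ℝ) :
    (∃ m : ℤ, |θ - (Real.pi / 2 + Real.pi * m)| ≤ r) ∨
      (∃ k : ℤ, -(Real.pi / 2) + 2 * Real.pi * k + r < θ ∧ θ + r < Real.pi / 2 + 2 * Real.pi * k) ∨
      (∃ k : ℤ, Real.pi / 2 + 2 * Real.pi * k + r < θ ∧ θ + r < 3 * Real.pi / 2 + 2 * Real.pi * k) := by
  have hπ : 0 < Real.pi := Real.pi_pos
  set m : ℤ := ⌊(θ + Real.pi / 2) / Real.pi⌋ with hm
  have hlo : (m : ℝ) ≤ (θ + Real.pi / 2) / Real.pi := Int.floor_le _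
  have hhi : (θ + Real.pi / 2) / Real.pi < m + 1 := Int.lt_floor_add_one _
  rw [le_div_iff₀ hπ] at hlo
  rw [div_lt_iff₀ hπ] at hhi
  -- `θ ∈ [−π/2 + πm, π/2 + πm)`
  by_cases h1 : θ - (-(Real.pi / 2) + Real.pi * m) ≤ r
  · left
    refine ⟨m - 1, ?_⟩
    rw [abs_le]; push_cast; constructor <;> nlinarith
  by_cases h2 : Real.pi / 2 + Real.pi * m - θ ≤ r
  · left
    refine ⟨m, ?_⟩
    rw [abs_le]; constructor <;> nlinarith
  push Not at h1 h2
  right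
  obtain ⟨k, hk | hk⟩ := Int.even_or_odd' m
  · left
    have hmk : (m : ℝ) = 2 * k := by rw [hk]; push_cast; ring
    rw [hmk] at h1 h2
    refine ⟨k, ?_, ?_⟩ <;> linarith
  · right
    have hmk : (m : ℝ) = 2 * k + 1 := by rw [hk]; push_cast; ring
    rw [hmk] at h1 h2
    refine ⟨k, ?_, ?_⟩ <;> linarith

/-! ## The zone of the cascade profile -/

/-- **Off the corner neighbourhoods the slope is near `±1`.**  If the phase `2πN_j y` is farther than `Mδ_j` from every
corner (`M ≥ 1`), then `|U_j′(y) − 1| ≤ 2e^{−M²/2}` or `|U_j′(y) + 1| ≤ 2e^{−M²/2}`.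
[cite: ElgindiLissMattingly2025, §1 (slope ±1 branches; here mollified)] -/
theorem slope_near_pm_one_of_far_from_corners (P : CascadeParams) {j : ℕ} (hδ : 0 < P.δ j) (hN : P.N j ≠ 0)
    {M y : ℝ} (hM : 1 ≤ M)
    (hfar : ∀ m : ℤ, M * P.δ j < |2 * Real.pi * P.N j * y - (Real.pi / 2 + Real.pi * m)|) :
    |deriv (P.U j) y - 1| ≤ 2 * Real.exp (-(M ^ 2 / 2)) ∨ |deriv (P.U j) y + 1| ≤ 2 * Real.exp (-(M ^ 2 / 2)) := by
  rcases flat_or_near_corner (2 * Real.pi * P.N j * y) (M * P.δ j) with ⟨m, hm⟩ | ⟨k, h₁, h₂⟩ | ⟨k, h₁, h₂⟩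
  · exact absurd hm (not_le.mpr (hfar m))
  · exact Or.inl (abs_deriv_U_sub_one_le P hδ hN hM k (by linarith) (by linarith))
  · exact Or.inr (abs_deriv_U_add_one_le P hδ hN hM k (by linarith) (by linarith))

/-- **The zone lies in the corner neighbourhoods.**  For `M ≥ 1` with `Mδ_j ≤ π/2`, every `y ∈ [0,1)` at which both
`|U_j′(y) ∓ 1| > 2e^{−M²/2}` lies within `Mδ_j/(2πN_j)` of a corner `y_m = (π/2 + πm)/(2πN_j)` with `−1 ≤ m ≤ 2N_j`.
[cite: ElgindiLissMattingly2025, §1 (corner strips)] -/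
theorem zone_subset_iUnion (P : CascadeParams) {j : ℕ} (hδ : 0 < P.δ j) (hN : P.N j ≠ 0) {M : ℝ} (hM : 1 ≤ M)
    (hMδ : M * P.δ j ≤ Real.pi / 2) :
    {y : ℝ | y ∈ Ico (0 : ℝ) 1 ∧ 2 * Real.exp (-(M ^ 2 / 2)) < |deriv (P.U j) y - 1| ∧
        2 * Real.exp (-(M ^ 2 / 2)) < |deriv (P.U j) y + 1|} ⊆
      ⋃ m ∈ Finset.Icc (-1 : ℤ) (2 * P.N j), Icc ((Real.pi / 2 + Real.pi * m) / (2 * Real.pi * P.N j) - M * P.δ j / (2 * Real.pi * P.N j))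
        ((Real.pi / 2 + Real.pi * m) / (2 * Real.pi * P.N j) + M * P.δ j / (2 * Real.pi * P.N j)) := by
  intro y hy
  obtain ⟨⟨hy0, hy1⟩, ha, hb⟩ := hy
  have hπ : 0 < Real.pi := Real.pi_pos
  have hNpos : (0 : ℝ) < P.N j := by exact_mod_cast Nat.pos_of_ne_zero hN
  have hc : 0 < 2 * Real.pi * P.N j := by positivity
  -- some corner is `Mδ`-close to the phase (else the slope would be near `±1`)
  have hnear : ∃ m : ℤ, |2 * Real.pi * P.N j * y - (Real.pi / 2 + Real.pi * m)| ≤ M * P.δ j := by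
    by_contra h
    push Not at h
    rcases slope_near_pm_one_of_far_from_corners P hδ hN hM h with h' | h'
    · exact absurd h' (not_le.mpr ha)
    · exact absurd h' (not_le.mpr hb)
  obtain ⟨m, hm⟩ := hnear
  rw [abs_le] at hm
  obtain ⟨hm1, hm2⟩ := hm
  -- the corner index is in `[-1, 2N]`
  have hθ0 : 0 ≤ 2 * Real.pi * P.N j * y := by positivity
  have hθ1 : 2 * Real.pi * P.N j * y < 2 * Real.pi * P.N j := by nlinarith
  have hm_lo : (-1 : ℤ) ≤ m := by
    have : (-2 : ℝ) < m := by nlinarith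
    exact_mod_cast (show (-2 : ℤ) < m by exact_mod_cast this)
  have hm_hi : m ≤ 2 * (P.N j : ℤ) := by
    have : (m : ℝ) < 2 * P.N j + 1 := by nlinarith
    have h' : (m : ℤ) < 2 * (P.N j : ℤ) + 1 := by exact_mod_cast this
    omega
  refine mem_iUnion₂.mpr ⟨m, Finset.mem_Icc.mpr ⟨hm_lo, by exact_mod_cast hm_hi⟩, ?_⟩
  rw [mem_Icc, ← sub_div, ← add_div, div_le_iff₀ hc, le_div_iff₀ hc]
  constructor <;> nlinarith

/-- **Measure of the zone.**  For `M ≥ 1` with `Mδ_j ≤ π/2`: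
`vol Z_j(M) ≤ (2N_j + 2)·(Mδ_j/(πN_j))` (the `2N_j + 2` corner intervals of length `Mδ_j/(πN_j)` each).
[cite: ElgindiLissMattingly2025, §1 (corner strips)] -/
theorem volume_zone_le (P : CascadeParams) {j : ℕ} (hδ : 0 < P.δ j) (hN : P.N j ≠ 0) {M : ℝ} (hM : 1 ≤ M)
    (hMδ : M * P.δ j ≤ Real.pi / 2) :
    volume {y : ℝ | y ∈ Ico (0 : ℝ) 1 ∧ 2 * Real.exp (-(M ^ 2 / 2)) < |deriv (P.U j) y - 1| ∧
        2 * Real.exp (-(M ^ 2 / 2)) < |deriv (P.U j) y + 1|} ≤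
      ENNReal.ofReal ((2 * P.N j + 2) * (M * P.δ j / (Real.pi * P.N j))) := by
  have hπ : 0 < Real.pi := Real.pi_pos
  have hNpos : (0 : ℝ) < P.N j := by exact_mod_cast Nat.pos_of_ne_zero hN
  have hc : 0 < 2 * Real.pi * P.N j := by positivity
  have hρ : 0 ≤ M * P.δ j / (2 * Real.pi * P.N j) := by positivity
  refine (measure_mono (zone_subset_iUnion P hδ hN hM hMδ)).trans ?_
  refine (measure_biUnion_finset_le _ _).trans ?_
  have hlen : ∀ m ∈ Finset.Icc (-1 : ℤ) (2 * P.N j),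
      volume (Icc ((Real.pi / 2 + Real.pi * m) / (2 * Real.pi * P.N j) - M * P.δ j / (2 * Real.pi * P.N j))
        ((Real.pi / 2 + Real.pi * m) / (2 * Real.pi * P.N j) + M * P.δ j / (2 * Real.pi * P.N j))) =
        ENNReal.ofReal (M * P.δ j / (Real.pi * P.N j)) := by
    intro m _
    rw [Real.volume_Icc]
    congr 1
    field_simp
    ring
  rw [Finset.sum_congr rfl hlen, Finset.sum_const, nsmul_eq_mul]
  have hcard : ((Finset.Icc (-1 : ℤ) (2 * P.N j)).card : ℝ≥0∞) = ENNReal.ofReal (2 * P.N j + 2) := by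
    rw [Int.card_Icc]
    have h : (2 * (P.N j : ℤ) + 1 - -1).toNat = 2 * P.N j + 2 := by omega
    rw [h]
    rw [show (2 * (P.N j : ℝ) + 2) = ((2 * P.N j + 2 : ℕ) : ℝ) by push_cast; ring, ENNReal.ofReal_natCast]
  rw [hcard, ← ENNReal.ofReal_mul (by positivity)]

/-- **Measure of the zone, simplified**: `vol Z_j(M) ≤ 4Mδ_j/π` (since `(2N+2)/N ≤ 4`).  With `δ_j = δ₀ d^{−j}` these are
summable in `j` for any fixed `M`, and for `M_j = c√j` as well. [cite: ElgindiLissMattingly2025, §1 (corner strips)] -/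
theorem volume_zone_le' (P : CascadeParams) {j : ℕ} (hδ : 0 < P.δ j) (hN : P.N j ≠ 0) {M : ℝ} (hM : 1 ≤ M)
    (hMδ : M * P.δ j ≤ Real.pi / 2) :
    volume {y : ℝ | y ∈ Ico (0 : ℝ) 1 ∧ 2 * Real.exp (-(M ^ 2 / 2)) < |deriv (P.U j) y - 1| ∧
        2 * Real.exp (-(M ^ 2 / 2)) < |deriv (P.U j) y + 1|} ≤ ENNReal.ofReal (4 * M * P.δ j / Real.pi) := by
  refine (volume_zone_le P hδ hN hM hMδ).trans (ENNReal.ofReal_le_ofReal ?_)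
  have hπ : 0 < Real.pi := Real.pi_pos
  have hN1 : (1 : ℝ) ≤ P.N j := by exact_mod_cast Nat.pos_of_ne_zero hN
  have hMδ0 : 0 ≤ M * P.δ j := by nlinarith
  rw [show (2 * (P.N j : ℝ) + 2) * (M * P.δ j / (Real.pi * P.N j)) = (M * P.δ j / Real.pi) * ((2 * P.N j + 2) / P.N j) by
    field_simp, show 4 * M * P.δ j / Real.pi = (M * P.δ j / Real.pi) * 4 by ring]
  refine mul_le_mul_of_nonneg_left ?_ (by positivity)
  rw [div_le_iff₀ (by linarith)]
  linarith

end Summit.AnomalousDissipation.AnomalousDissipation.Theorems.SawtoothPulseCascade.K1Flat
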